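import Mathlib.Analysis.InnerProductSpace.Laplacian
import Literature.Analysis.FluidPDE.CarlemanCalculus
import Literature.Analysis.FluidPDE.WeakSolution
import HarnessLib

/-!
# Curried vs. uncurried space–time fields: `timeDeriv`/`Δ`/`fderiv` vs. `Carleman.dt`/`lap`/`dx`

Analysis/FluidPDE support file in the backward-uniqueness track of the decomposition of
**ns.S08** `Literature.Analysis.FluidPDE.ess_endpoint`. The vendored targets
`ess_unique_continuation` / `ess_backward_uniqueness` (ESS 2003, Thms. 4.1/5.1) are stated for
curried fields `u : ℝ → E → F` with `FluidPDE.timeDeriv u t x`, Mathlib's Laplacian `Δ (u t) x`,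
the operator norm `‖fderiv ℝ (u t) x‖` and `‖iteratedFDeriv ℝ 2 (u t) x‖`, while the Carleman
files work with uncurried `U = uncurry u : ℝ × E → F` and the frame operators `Carleman.dt`,
`Carleman.dx`, `Carleman.lap`, `Carleman.gradSq`. This file proves the dictionary at points
where `uncurry u` is (twice) differentiable:

* `dt_uncurry` — `dt (uncurry u) (t, x) = timeDeriv u t x`;
* `dx_uncurry` — `dx e (uncurry u) (t, x) = fderiv ℝ (u t) x e`;
* `dx_dx_uncurry` — `dx e (dx e (uncurry u)) (t, x) = iteratedFDeriv ℝ 2 (u t) x ![e, e]`;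
* `lap_uncurry` — `lap (uncurry u) (t, x) = Δ (u t) x`;
* `opNorm_fderiv_le_sqrt_gradSq` — `‖fderiv ℝ (u t) x‖ ≤ √(gradSq (uncurry u) (t,x))`
  (operator norm ≤ Frobenius norm);
* `norm_dx_dx_le_norm_iteratedFDeriv` — `‖∂ᵢ∂ⱼ(uncurry u)(t,x)‖ ≤ ‖iteratedFDeriv ℝ 2 (u t) x‖`
  for unit frame vectors.

All statements are proved.
-/

noncomputable section

open MeasureTheory Set Function Filter Topology InnerProductSpace Laplacian
open scoped InnerProductSpace RealInnerProductSpace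

namespace Literature.Analysis.FluidPDE

namespace Carleman

section Curry

variable {E : Type*} [NormedAddCommGroup E] [InnerProductSpace ℝ E] [FiniteDimensional ℝ E]
variable {F : Type*} [NormedAddCommGroup F] [InnerProductSpace ℝ F]

omit [FiniteDimensional ℝ E] in
/-- **Partial derivative in `x` of a jointly differentiable function**:
`D(G)(t, x)(0, e) = D(G(t, ·))(x) e`. [folklore] -/
theorem fderiv_apply_zero_eq_fderiv_slice {G : ℝ × E → F} {t : ℝ} {x : E}
    (hG : DifferentiableAt ℝ G (t, x)) (e : E) :
    fderiv ℝ G (t, x) (0, e) = fderiv ℝ (fun y => G (t, y)) x e := by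
  have h : HasFDerivAt (fun y => G (t, y)) ((fderiv ℝ G (t, x)).comp (ContinuousLinearMap.inr ℝ ℝ E)) x :=
    hG.hasFDerivAt.comp x (hasFDerivAt_prodMk_right t x)
  rw [h.fderiv]
  simp

omit [FiniteDimensional ℝ E] in
/-- **Partial derivative in `t` of a jointly differentiable function**:
`D(G)(t, x)(1, 0) = d/ds G(s, x)|_{s=t}`. [folklore] -/
theorem fderiv_apply_one_zero_eq_deriv_slice {G : ℝ × E → F} {t : ℝ} {x : E}
    (hG : DifferentiableAt ℝ G (t, x)) :
    fderiv ℝ G (t, x) (1, 0) = deriv (fun s => G (s, x)) t := by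
  have h : HasFDerivAt (fun s => G (s, x)) ((fderiv ℝ G (t, x)).comp (ContinuousLinearMap.inl ℝ ℝ E)) t :=
    hG.hasFDerivAt.comp t (hasFDerivAt_prodMk_left t x)
  have h' : HasDerivAt (fun s => G (s, x)) (fderiv ℝ G (t, x) (1, 0)) t := by
    have := h.hasDerivAt
    simpa using this
  exact h'.deriv.symm

variable {u : ℝ → E → F} {t : ℝ} {x : E}

omit [FiniteDimensional ℝ E] in
/-- `∂ₜ` of the uncurried field is the curried time derivative:
`dt (uncurry u) (t, x) = timeDeriv u t x`. [folklore] -/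
theorem dt_uncurry (h : DifferentiableAt ℝ (uncurry u) (t, x)) :
    dt (uncurry u) (t, x) = FluidPDE.timeDeriv u t x := by
  rw [dt_apply, fderiv_apply_one_zero_eq_deriv_slice h, FluidPDE.timeDeriv_apply]
  rfl

omit [FiniteDimensional ℝ E] in
/-- `∂ₑ` of the uncurried field is the curried spatial derivative:
`dx e (uncurry u) (t, x) = fderiv ℝ (u t) x e`. [folklore] -/
theorem dx_uncurry (h : DifferentiableAt ℝ (uncurry u) (t, x)) (e : E) :
    dx e (uncurry u) (t, x) = fderiv ℝ (u t) x e := by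
  rw [dx_apply, fderiv_apply_zero_eq_fderiv_slice h]
  rfl

omit [FiniteDimensional ℝ E] in
/-- Second spatial derivatives: if `uncurry u` is `C²` on a neighbourhood of `(t, x)`, then
`dx e (dx e' (uncurry u)) (t, x) = D(y ↦ D(u t)(y) e')(x) e` (`= D²(u t)(x)[e, e']`). [folklore] -/
theorem dx_dx_uncurry {U : Set (ℝ × E)} (hU : IsOpen U) (hz : (t, x) ∈ U)
    (h : ContDiffOn ℝ 2 (uncurry u) U) (e e' : E) :
    dx e (dx e' (uncurry u)) (t, x) = fderiv ℝ (fun y => fderiv ℝ (u t) y e') x e := by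
  -- near `(t, x)`, `dx e' (uncurry u) = fun z => fderiv (u z.1) z.2 e'`
  have hd : ∀ z ∈ U, DifferentiableAt ℝ (uncurry u) z := fun z hz' =>
    (h.differentiableOn (by norm_num)).differentiableAt (hU.mem_nhds hz')
  have hev : dx e' (uncurry u) =ᶠ[𝓝 (t, x)] fun z => fderiv ℝ (u z.1) z.2 e' := by
    filter_upwards [hU.mem_nhds hz] with z hz'
    rw [show z = (z.1, z.2) from rfl, dx_uncurry (hd _ hz')]
  rw [dx_apply, hev.fderiv_eq]
  -- the function `G z = fderiv (u z.1) z.2 e'` is differentiable at `(t,x)`: it equals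
  -- `z ↦ D(uncurry u)(z)(0,e')` near `(t,x)`, which is `C¹`
  have hG : DifferentiableAt ℝ (fun z : ℝ × E => fderiv ℝ (u z.1) z.2 e') (t, x) := by
    have h1 : ContDiffOn ℝ 1 (fun z => fderiv ℝ (uncurry u) z (0, e')) U :=
      (h.fderiv_of_isOpen hU le_rfl).clm_apply contDiffOn_const
    have h2 : DifferentiableAt ℝ (fun z => fderiv ℝ (uncurry u) z (0, e')) (t, x) :=
      (h1.differentiableOn one_ne_zero).differentiableAt (hU.mem_nhds hz)
    refine h2.congr_of_eventuallyEq ?_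
    filter_upwards [hU.mem_nhds hz] with z hz'
    rw [show z = (z.1, z.2) from rfl, ← dx_apply, dx_uncurry (hd _ hz')]
  rw [fderiv_apply_zero_eq_fderiv_slice hG e]

/-- **The frame Laplacian of the uncurried field is Mathlib's Laplacian of the slice**:
`lap (uncurry u) (t, x) = Δ (u t) x` (`Δ f x = Σᵢ D²f(x)[bᵢ, bᵢ]`,
`InnerProductSpace.laplacian_eq_iteratedFDeriv_stdOrthonormalBasis`). [folklore] -/
theorem lap_uncurry {U : Set (ℝ × E)} (hU : IsOpen U) (hz : (t, x) ∈ U)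
    (h : ContDiffOn ℝ 2 (uncurry u) U) :
    lap (uncurry u) (t, x) = (Δ (u t)) x := by
  rw [laplacian_eq_iteratedFDeriv_stdOrthonormalBasis]
  simp only [lap]
  refine Finset.sum_congr rfl fun i _ => ?_
  rw [dx_dx_uncurry hU hz h, iteratedFDeriv_two_apply]
  simp only [Matrix.cons_val_zero, Matrix.cons_val_one]
  -- `fderiv (fun y => fderiv (u t) y b) x b = fderiv (fderiv (u t)) x b b`
  have hut : ContDiffAt ℝ 2 (u t) x := by
    have hc : ContDiffAt ℝ 2 (uncurry u) (t, x) := h.contDiffAt (hU.mem_nhds hz)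
    exact hc.comp x (contDiffAt_const.prodMk contDiffAt_id)
  have hd : DifferentiableAt ℝ (fderiv ℝ (u t)) x :=
    (hut.fderiv_right (m := 1) le_rfl).differentiableAt one_ne_zero
  rw [fderiv_clm_apply hd (differentiableAt_const _)]
  simp

/-- **Operator norm ≤ Frobenius norm**: `‖D(u t)(x)‖ ≤ √(Σᵢ |∂ᵢ(uncurry u)(t,x)|²)`. [folklore] -/
theorem opNorm_fderiv_le_sqrt_gradSq (h : DifferentiableAt ℝ (uncurry u) (t, x)) :
    ‖fderiv ℝ (u t) x‖ ≤ Real.sqrt (gradSq (uncurry u) (t, x)) := by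
  set b := stdOrthonormalBasis ℝ E with hb
  set L := fderiv ℝ (u t) x with hL
  have hcoord : ∀ i, dx (b i) (uncurry u) (t, x) = L (b i) := fun i => dx_uncurry h (b i)
  refine ContinuousLinearMap.opNorm_le_bound _ (Real.sqrt_nonneg _) fun v => ?_
  -- `L v = Σ ⟪v, bᵢ⟫ L bᵢ`, Cauchy–Schwarz
  have hv : L v = ∑ i, ⟪v, b i⟫ • L (b i) := by
    conv_lhs => rw [← b.sum_repr' v]
    simp [map_sum, map_smul, real_inner_comm]
  rw [hv]
  calc ‖∑ i, ⟪v, b i⟫ • L (b i)‖ ≤ ∑ i, ‖⟪v, b i⟫ • L (b i)‖ := norm_sum_le _ _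
    _ = ∑ i, |⟪v, b i⟫| * ‖L (b i)‖ := by simp [norm_smul]
    _ ≤ Real.sqrt (∑ i, |⟪v, b i⟫| ^ 2) * Real.sqrt (∑ i, ‖L (b i)‖ ^ 2) :=
        Real.sum_mul_le_sqrt_mul_sqrt _ _ _
    _ = ‖v‖ * Real.sqrt (gradSq (uncurry u) (t, x)) := by
        congr 1
        · rw [show ∑ i, |⟪v, b i⟫| ^ 2 = ∑ i, ⟪v, b i⟫ ^ 2 from
            Finset.sum_congr rfl fun i _ => sq_abs _, b.sum_sq_inner_left, Real.sqrt_sq (norm_nonneg _)]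
        · simp only [gradSq, ← hcoord]
          rfl
    _ = Real.sqrt (gradSq (uncurry u) (t, x)) * ‖v‖ := mul_comm _ _

/-- **Frame Hessian entries are bounded by the norm of the second derivative**:
`‖∂ᵢ∂ⱼ(uncurry u)(t,x)‖ ≤ ‖iteratedFDeriv ℝ 2 (u t) x‖` for the unit vectors of the standard
frame. [folklore] -/
theorem norm_dx_dx_le_norm_iteratedFDeriv {U : Set (ℝ × E)} (hU : IsOpen U) (hz : (t, x) ∈ U)
    (h : ContDiffOn ℝ 2 (uncurry u) U) (i j : Fin (Module.finrank ℝ E)) :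
    ‖dx (stdOrthonormalBasis ℝ E i) (dx (stdOrthonormalBasis ℝ E j) (uncurry u)) (t, x)‖ ≤
      ‖iteratedFDeriv ℝ 2 (u t) x‖ := by
  set b := stdOrthonormalBasis ℝ E with hb
  have hut : ContDiffAt ℝ 2 (u t) x := by
    have hc : ContDiffAt ℝ 2 (uncurry u) (t, x) := h.contDiffAt (hU.mem_nhds hz)
    exact hc.comp x (contDiffAt_const.prodMk contDiffAt_id)
  have hd : DifferentiableAt ℝ (fderiv ℝ (u t)) x :=
    (hut.fderiv_right (m := 1) le_rfl).differentiableAt one_ne_zero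
  have e1 : dx (b i) (dx (b j) (uncurry u)) (t, x) = iteratedFDeriv ℝ 2 (u t) x ![b i, b j] := by
    rw [dx_dx_uncurry hU hz h, iteratedFDeriv_two_apply]
    simp only [Matrix.cons_val_zero, Matrix.cons_val_one]
    rw [fderiv_clm_apply hd (differentiableAt_const _)]
    simp
  rw [e1]
  refine (ContinuousMultilinearMap.le_opNorm _ _).trans ?_
  have : ∏ k : Fin 2, ‖(![b i, b j] : Fin 2 → E) k‖ = 1 := by
    simp [Fin.prod_univ_two, b.norm_eq_one]
  rw [this, mul_one]

end Curry

end Carleman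

end Literature.Analysis.FluidPDE
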